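import Summits.QuantumFields.YangMills.Theorems.ColdStartUniversalityLatticeLangevinAutocorrelationTime
import Summits.QuantumFields.YangMills.Theorems.ColdStartUniversalityLatticeLangevinBakryEmeryUniformGap
import HarnessLib

/-!
# Route `ColdStartUniversality` (fixed-cut-off package): VOLUME-UNIFORM EXPONENTIAL DECAY OF STATIONARY TIME-CORRELATIONS of the SU(2) SZZ
# dynamics on `(ℤ/L)³` at `|β'| < 1/12` — `|⟨G, P_tF⟩_(μ_β')| ≤ e^(−(1−12|β'|)t) ‖F‖ ‖G‖` for centred continuous `F, G`

Helper file (seat `ym-line-csu-p1`, g27; `--supports stmt-QuantumFields-24809`).  g16's `abs_integral_mul_transition_le` with its existential Doeblin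
rate replaced by the volume-uniform `L²` rate of g25 (`wilson_spectralGap_uniform`):
* ★★ `wilson_crossCorrelation_le_uniform` — for `|β'| < 1/12`, every realising kernel family, centred continuous `F, G` and every lattice time `t`:
  `|∫ G·κ_tF dμ_(β')| ≤ e^(−(1−12|β'|)t) ‖F‖_(L²(μ)) ‖G‖_(L²(μ))` — stationary time-correlations of ANY two observables decay at the `L`-independent rate.
[cite: RobertsRosenthal1997, Theorem 2.1]  THEOREMS ONLY, no definition, no sorry.  HONEST FRAMING: FIXED cut-off and fixed `|β'| < 1/12`; 24809 ASIDE
not restated; no crux, rung or summit statement is proved; the Yang–Mills mass gap is NOT proved.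
-/

set_option autoImplicit false

noncomputable section

namespace Summit.QuantumFields.YangMills.Theorems.ColdStartUniversality

open MeasureTheory ProbabilityTheory Finset Filter Set Topology
open scoped BigOperators NNReal ENNReal
open Literature.Probability.Process Literature.MathematicalPhysics.QuantumFieldTheory
open Literature.MathematicalPhysics.QuantumLattice (fundamentalRep fundamentalLatticeRep continuous_fundamentalRep)

variable {L : ℕ} [NeZero L]

/-- ★★ **Volume-uniform decay of stationary time-correlations** (`|β'| < 1/12`): for centred continuous `F, G`, every realising kernel family
and every lattice time `t`, `|∫ G·κ_tF dμ_(β')| ≤ e^(−(1−12|β'|)t) ‖F‖_(L²(μ_β')) ‖G‖_(L²(μ_β'))` (Cauchy–Schwarz + `‖κ_tF‖ ≤ e^(−(1−12|β'|)t)‖F‖`).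
[cite: RobertsRosenthal1997, Theorem 2.1] -/
theorem wilson_crossCorrelation_le_uniform (L : ℕ) [NeZero L] (β' : ℝ) (hβ : |β'| < 1 / 12)
    (κ : ℝ≥0 → Kernel (GaugeConfig 3 L (Matrix.specialUnitaryGroup (Fin 2) ℂ)) (GaugeConfig 3 L (Matrix.specialUnitaryGroup (Fin 2) ℂ))) [∀ t, IsMarkovKernel (κ t)]
    (hreal : ∀ (t : ℝ≥0) (x : (GaugeConfig 3 L (Matrix.specialUnitaryGroup (Fin 2) ℂ)))
        (Ω : Type) [MeasurableSpace Ω] (P : Measure Ω) [IsProbabilityMeasure P]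
        (W : ℝ≥0 → Ω → (Edge 3 L × NoiseIdx 2 → ℝ)) (hW : IsFlatBrownian W P)
        (U : ℝ≥0 → Ω → (GaugeConfig 3 L (Matrix.specialUnitaryGroup (Fin 2) ℂ))),
        (∀ ω, U 0 ω = x) →
        (latticeLangevinDynamics (fundamentalLatticeRep 2) β').IsSolution (fundamentalRep (Fin 2))
          hW.natFiltration P W U →
        κ t x = P.map (U t))
    (F G' : (GaugeConfig 3 L (Matrix.specialUnitaryGroup (Fin 2) ℂ)) → ℝ) (hF : Continuous F) (hG : Continuous G')
    (hF0 : ∫ x, F x ∂(wilsonMeasure (d := 3) (L := L) (fundamentalRep (Fin 2)) β') = 0) (t : ℝ≥0) :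
    |∫ x, G' x * (∫ y, F y ∂(κ t x)) ∂(wilsonMeasure (d := 3) (L := L) (fundamentalRep (Fin 2)) β')| ≤
      Real.exp (-(1 - 12 * |β'|) * t) * Real.sqrt (∫ x, F x * F x ∂(wilsonMeasure (d := 3) (L := L) (fundamentalRep (Fin 2)) β')) * Real.sqrt (∫ x, G' x * G' x ∂(wilsonMeasure (d := 3) (L := L) (fundamentalRep (Fin 2)) β')) := by
  classical
  haveI := secondCountableTopology_su2
  haveI := borelSpace_config L
  haveI : IsProbabilityMeasure (wilsonMeasure (d := 3) (L := L) (fundamentalRep (Fin 2)) β') :=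
    isProbabilityMeasure_wilsonMeasure (d := 3) (L := L) (fundamentalRep (Fin 2)) (continuous_fundamentalRep (Fin 2)) β'
  set μ : Measure (GaugeConfig 3 L (Matrix.specialUnitaryGroup (Fin 2) ℂ)) := (wilsonMeasure (d := 3) (L := L) (fundamentalRep (Fin 2)) β') with hμ
  obtain ⟨MF, -, hMF⟩ := exists_abs_le_of_continuous hF
  obtain ⟨MG, -, hMG⟩ := exists_abs_le_of_continuous hG
  have hκF : Continuous fun x => ∫ y, F y ∂(κ t x) := continuous_integral_transitionKernel L β' κ hreal t hF
  have hκFb : ∀ x, |∫ y, F y ∂(κ t x)| ≤ MF := fun x => abs_integral_le_of_abs_le_of_isProbabilityMeasure hMF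
  have hCS := sq_integral_mul_le_integral_sq_mul μ hG.measurable hκF.measurable hMG hκFb
  -- the uniform `L²` decay for the centred `F`
  have hL2 : ∫ x, (∫ y, F y ∂(κ t x)) ^ 2 ∂μ ≤ Real.exp (-2 * (1 - 12 * |β'|) * t) * ∫ x, F x * F x ∂μ := by
    have h := wilson_spectralGap_uniform L β' hβ κ hreal hF t
    have hmF : ∫ z, F z ∂μ = 0 := hF0
    rw [hmF] at h
    simp only [sub_zero] at h
    have e : ∫ x, (F x) ^ 2 ∂μ = ∫ x, F x * F x ∂μ := integral_congr_ae (ae_of_all _ fun x => by ring)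
    rw [e] at h
    exact h
  set A : ℝ := ∫ x, F x * F x ∂μ with hA
  set B : ℝ := ∫ x, G' x * G' x ∂μ with hB
  have hA0 : 0 ≤ A := integral_nonneg fun x => mul_self_nonneg _
  have hB0 : 0 ≤ B := integral_nonneg fun x => mul_self_nonneg _
  have hB' : ∫ x, (G' x) ^ 2 ∂μ = B := integral_congr_ae (Eventually.of_forall fun x => by simp [sq])
  rw [hB'] at hCS
  have h2 : (∫ x, G' x * (∫ y, F y ∂(κ t x)) ∂μ) ^ 2 ≤ (Real.exp (-(1 - 12 * |β'|) * t)) ^ 2 * A * B := by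
    calc (∫ x, G' x * (∫ y, F y ∂(κ t x)) ∂μ) ^ 2 ≤ B * ∫ x, (∫ y, F y ∂(κ t x)) ^ 2 ∂μ := hCS
      _ ≤ B * (Real.exp (-2 * (1 - 12 * |β'|) * t) * A) := mul_le_mul_of_nonneg_left hL2 hB0
      _ = (Real.exp (-(1 - 12 * |β'|) * t)) ^ 2 * A * B := by
          rw [← Real.exp_nat_mul]; push_cast; ring_nf
  have hrhs : 0 ≤ Real.exp (-(1 - 12 * |β'|) * t) * Real.sqrt A * Real.sqrt B := by positivity
  rw [← Real.sqrt_sq hrhs]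
  refine Real.abs_le_sqrt ?_
  rw [mul_pow, mul_pow, Real.sq_sqrt hA0, Real.sq_sqrt hB0]
  exact h2

end Summit.QuantumFields.YangMills.Theorems.ColdStartUniversality
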